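import Summits.HodgeConjecture.CorCM.MumfordTateRankRibetTypeOnePairsSameField
import Summits.HodgeConjecture.CorCM.MumfordTateRankUnitaryPairSubalgebra
import Summits.HodgeConjecture.CorCM.MumfordTateRankRigidMonotone
import HarnessLib

/-!
# Two Ribet-type abelian varieties of DIFFERENT dimensions: `H¹(A × A′)` is `Θ`-rigid, hence `t((A × A′) × Y) ≥ t(A × A′)` for every `Y`
# (every bracket-closed rational subalgebra of `Lie Hg(H¹(A × A′))` whose complexification contains `Θ` is everything — by counting dimensions)

COR-CM (cell `pub-hodgecm2`, seat `b27` gen 53, count-neutral Mumford–Tate-rank ladder; theorems only, no definition, no named fact; UNCONDITIONAL —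
nothing here uses or asserts HC_CM).  `Θ`-RIGIDITY of a weight-one Hodge structure (the treeʼs substitute for «`MT(H ⊕ H′) ↠ MT(H)`», gens 48–51:
`CorCM/MumfordTateRankRigidMonotone`, `Motives/HodgeLieRigidTimes*`) is what makes it usable as a FACTOR.  HERE: for `A`, `A′` of Ribet types
`(g−1,1)`, `(g′−1,1)` with `g ≠ g′` (both `≥ 3`), **`H¹(A × A′)` is `Θ`-rigid**.  PROOF (no intertwiners).  Let `𝔞 ⊆ 𝔥 = Lie Hg(H¹(A × A′))` be
bracket-closed with `Θ ∈ 𝔞 ⊗ ℂ`.  The block restrictions `r_i(𝔞)` equal `𝔥_i = Lie Hg(H¹A_i)` (rigidity of the factors), so by COUNTING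
(`UnitaryPair.corners_le_of_subalgebra_of_finrank_ne`: `dim 𝔞 = k₁ + g′² = k₂ + g²`, `k_i ≤ 1` or `k_i ≥ g_i² − 1` since `r_i(𝔞 ∩ ker r_j)` is an
ideal of `ℚφ_i ⊕ 𝔡_i` with `𝔡_i` simple) BOTH DERIVED CORNERS lie in `𝔞` and `dim 𝔞 ≥ g² + g′² − 1`.  Isomorphic fields: `dim 𝔥 = g² + g′² − 1`
(`…PairsSameField`), so `𝔞 = 𝔥`.  Non-isomorphic fields: the trace test for `𝔞` (`UnitaryPair.incl_phi_proj_mem_of_subalgebra_of_nonresonant`,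
`[𝔥,𝔥] = ι₁𝔡₁π₁ ⊕ ι₂𝔡₂π₂ ⊆ 𝔞`) puts `ι₁φ₁π₁ ∈ 𝔞`, so `𝔞 ⊇ ι₁𝔥₁π₁` and `dim 𝔞 ≥ g² + g′² = dim 𝔥`.
* **`hodgeLie_rigid_prod_ribetTypeOne_of_dim_ne`**; **`mtRank_hodge_one_le_of_isIsogenous_prod_ribetTypeOne_prod`** — `t(X) ≥ t(A × A′)` for
  `X ∼ (A × A′) × Y` (`mtRank_hodge_one_le_of_isIsogenous_prod_of_rigid`).

## References
* [MoonenZarhin1999LowDim] B. Moonen, Yu. G. Zarhin, *Hodge classes on abelian varieties of low dimension*, Math. Ann. 315 (1999), §3 (3.1), Lemma (3.4),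
  Prop. (3.8) [corpus: paper:arxiv-math_9901113 p. 6]. [cite: MoonenZarhin1999LowDim, §3 (3.1) and Lemma (3.4)]
* [Hazama1983] F. Hazama, Tôhoku Math. J. 35 (1983), Lemma (3.1). [cite: Hazama1983, Lemma (3.1)]
* [Moonen1999MTNotes] B. Moonen, *Notes on Mumford–Tate groups* (1999), (1.7)–(1.8). [cite: Moonen1999MTNotes, (1.7) and (1.8)]
* [Ribet1983] K. A. Ribet, Amer. J. Math. 105 (1983), Thm. 3. [cite: Ribet1983, Thm. 3]
-/

noncomputable section

open scoped TensorProduct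
open CategoryTheory CategoryTheory.Limits Module NumberField

namespace Summit.HodgeConjecture.CorCM

open Literature.AlgebraicGeometry.Motives
open Literature.AlgebraicGeometry.Motives.AbelianVariety
open Literature.AlgebraicGeometry.Motives.HodgeStructure
open Literature.AlgebraicGeometry.HodgeTheory
open Literature.AlgebraicGeometry.ComplexMultiplication

variable [HodgeTensorFacts.{0, 0}] {X : AbelianVariety ℂ} {n : ℕ}

set_option maxHeartbeats 1600000 in
/-- **`H¹(A × A′)` is `Θ`-rigid for `A`, `A′` of Ribet types `(g−1,1)`, `(g′−1,1)` with `g ≠ g′`**: every bracket-closed rational subalgebra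
`𝔞 ⊆ Lie Hg(H¹(A × A′))` whose complex span contains a Hodge operator `Θ` is all of `Lie Hg(H¹(A × A′))` (module docstring: counting for the derived
corners; the dimension `g² + g′² − 1` resp. the trace test for the centre). [cite: MoonenZarhin1999LowDim, §3 (3.1) and Lemma (3.4)]
[cite: Hazama1983, Lemma (3.1)] [cite: Moonen1999MTNotes, (1.7) and (1.8)] -/
theorem hodgeLie_rigid_prod_ribetTypeOne_of_dim_ne {A A' : AbelianVariety ℂ} {m : ℕ} (hP : IsSmoothProjective m (A.prod A').X)
    (hF : IsField A.endAlgebra) (hnR : ¬ IsTotallyReal (EndField A hF)) (φ : A ⟶ A) {d : ℕ} (hd : 0 < d) (hφ : φ ≫ φ = -(d • 𝟙 A))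
    (hAE : Module.finrank ℚ A.endAlgebra = 2)
    (h1 : eigenMultiplicity A φ (Complex.I * (Real.sqrt d : ℂ)) = 1 ∨ eigenMultiplicity A φ (-(Complex.I * (Real.sqrt d : ℂ))) = 1) (hdim : 3 ≤ A.dim)
    (hF' : IsField A'.endAlgebra) (hnR' : ¬ IsTotallyReal (EndField A' hF')) (φ' : A' ⟶ A') {d' : ℕ} (hd' : 0 < d') (hφ' : φ' ≫ φ' = -(d' • 𝟙 A'))
    (hA'E : Module.finrank ℚ A'.endAlgebra = 2)
    (h1' : eigenMultiplicity A' φ' (Complex.I * (Real.sqrt d' : ℂ)) = 1 ∨ eigenMultiplicity A' φ' (-(Complex.I * (Real.sqrt d' : ℂ))) = 1)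
    (hdim' : 3 ≤ A'.dim) (hne : A.dim ≠ A'.dim) :
    haveI := BettiUniverse.finite hP 1
    ∀ 𝔞 : Submodule ℚ (Module.End ℚ (bettiCohomology (A.prod A').X 1)),
      𝔞 ≤ (BettiUniverse.hodge exists_isReal_hodgeModel_holds hP 1).hodgeLie →
      (∀ B ∈ 𝔞, ∀ B' ∈ 𝔞, B * B' - B' * B ∈ 𝔞) →
      (∃ Θ ∈ Submodule.span ℂ ((fun B : Module.End ℚ (bettiCohomology (A.prod A').X 1) => B.baseChange ℂ) ''
          (𝔞 : Set (Module.End ℚ (bettiCohomology (A.prod A').X 1)))),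
        ∀ p, ∀ x ∈ (BettiUniverse.hodge exists_isReal_hodgeModel_holds hP 1).piece p (((1 : ℕ) : ℤ) - p),
          Θ x = ((2 * p - ((1 : ℕ) : ℤ) : ℤ) : ℂ) • x) →
      (BettiUniverse.hodge exists_isReal_hodgeModel_holds hP 1).hodgeLie ≤ 𝔞 := by
  classical
  have hnP : (A.prod A').dim = m := schemeDim_eq_holds hP
  subst hnP
  have hT : IsSmoothProjective A.dim A.X := AbelianVariety.isSmoothProjective_holds
  have hT' : IsSmoothProjective A'.dim A'.X := AbelianVariety.isSmoothProjective_holds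
  haveI := BettiUniverse.finite hP 1
  haveI := BettiUniverse.finite hT 1
  haveI := BettiUniverse.finite hT' 1
  intro 𝔞 h𝔞 hbr hΘex
  have hni : ¬ IsIsogenous A A' := fun h => by
    obtain ⟨f, hf⟩ := h
    exact hne (dim_eq_of_isIsogeny hf)
  -- per-factor data
  obtain ⟨μ₁, k₁, hφ₁E, hφ₁2, hE₁, hμ₁, h1₁, h2₁, hφ₁𝔥, hZ₁, hσ₁, hk₁, hτ₁⟩ := ribetTypeOne_factor_data hT φ hd hφ hAE h1 hdim
  obtain ⟨μ₂, k₂, hφ₂E, hφ₂2, hE₂, hμ₂, h1₂, h2₂, hφ₂𝔥, hZ₂, hσ₂, hk₂, hτ₂⟩ := ribetTypeOne_factor_data hT' φ' hd' hφ' hA'E h1' hdim'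
  obtain ⟨hsimple₁, hcent₁, h8₁⟩ := derived_facts_of_ribetTypeOne hT hF hnR φ hd hφ hAE h1 hdim
  obtain ⟨hsimple₂, hcent₂, h8₂⟩ := derived_facts_of_ribetTypeOne hT' hF' hnR' φ' hd' hφ' hA'E h1' hdim'
  have h9₁ := (mtRank_hodge_one_of_ribetTypeOne' hT hF hnR φ hd hφ hAE h1 hdim).2
  have h9₂ := (mtRank_hodge_one_of_ribetTypeOne' hT' hF' hnR' φ' hd' hφ' hA'E h1' hdim').2
  set φ₁ : Module.End ℚ (bettiCohomology A.X 1) := (bettiCohomology.map φ.hom.hom.hom 1).hom with hφ₁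
  set φ₂ : Module.End ℚ (bettiCohomology A'.X 1) := (bettiCohomology.map φ'.hom.hom.hom 1).hom with hφ₂
  set H := BettiUniverse.hodge exists_isReal_hodgeModel_holds hP 1 with hHdef
  set H₁ := BettiUniverse.hodge exists_isReal_hodgeModel_holds hT 1 with hH₁def
  set H₂ := BettiUniverse.hodge exists_isReal_hodgeModel_holds hT' 1 with hH₂def
  obtain ⟨ψ₁⟩ := BettiUniverse.hodge_isPolarizable exists_isReal_hodgeModel_holds hT 1
  obtain ⟨ψ₂⟩ := BettiUniverse.hodge_isPolarizable exists_isReal_hodgeModel_holds hT' 1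
  obtain ⟨ψ⟩ := BettiUniverse.hodge_isPolarizable exists_isReal_hodgeModel_holds hP 1
  have hd₁Q : (0 : ℚ) < d := Nat.cast_pos.2 hd
  have hd₂Q : (0 : ℚ) < d' := Nat.cast_pos.2 hd'
  -- the bicone of `H¹(A × A')`
  let ι₁ := BettiUniverse.pullHodgeHom exists_isReal_hodgeModel_holds hodgePQ_independent_of_hodgeModel_holds hP hT (fst A A').hom.hom.hom 1
  let π₁ := BettiUniverse.pullHodgeHom exists_isReal_hodgeModel_holds hodgePQ_independent_of_hodgeModel_holds hT hP
    (prodLift (𝟙 A) (0 : A ⟶ A')).hom.hom.hom 1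
  let ι₂ := BettiUniverse.pullHodgeHom exists_isReal_hodgeModel_holds hodgePQ_independent_of_hodgeModel_holds hP hT' (snd A A').hom.hom.hom 1
  let π₂ := BettiUniverse.pullHodgeHom exists_isReal_hodgeModel_holds hodgePQ_independent_of_hodgeModel_holds hT' hP
    (prodLift (0 : A' ⟶ A) (𝟙 A')).hom.hom.hom 1
  have hsumP : fst A A' ≫ prodLift (𝟙 A) (0 : A ⟶ A') + snd A A' ≫ prodLift (0 : A' ⟶ A) (𝟙 A') = 𝟙 _ := by
    refine prod_hom_ext ?_ ?_
    · rw [Preadditive.add_comp, Category.assoc, Category.assoc, prodLift_fst, prodLift_fst, Category.comp_id, comp_zero, add_zero, Category.id_comp]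
    · rw [Preadditive.add_comp, Category.assoc, Category.assoc, prodLift_snd, prodLift_snd, Category.comp_id, comp_zero, zero_add, Category.id_comp]
  have hπι₁ : ∀ v, π₁.toLinearMap (ι₁.toLinearMap v) = v := fun v => pull_pull_eq_self_of_comp_eq_id (prodLift_fst _ _) v
  have hπι₂ : ∀ v, π₂.toLinearMap (ι₂.toLinearMap v) = v := fun v => pull_pull_eq_self_of_comp_eq_id (prodLift_snd _ _) v
  have hsum : ∀ v, ι₁.toLinearMap (π₁.toLinearMap v) + ι₂.toLinearMap (π₂.toLinearMap v) = v := fun v =>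
    pull_pull_add_pull_pull_eq_self _ _ _ _ hsumP v
  -- the skew centre of `Lie Hg(H¹(A × A'))` is on `ℚ ι₁φ₁π₁ + ℚ ι₂φ₂π₂`
  have hZ : ∀ z ∈ H.hodgeLie ⊓ Subalgebra.toSubmodule H.endAlg, ∃ x₁ x₂ : ℚ,
      z = x₁ • (ι₁.toLinearMap ∘ₗ φ₁ ∘ₗ π₁.toLinearMap) + x₂ • (ι₂.toLinearMap ∘ₗ φ₂ ∘ₗ π₂.toLinearMap) := by
    intro z hz
    obtain ⟨hz𝔥, hzE⟩ := Submodule.mem_inf.1 hz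
    rw [Subalgebra.mem_toSubmodule] at hzE
    have hb := eq_sum_blocks_of_mem_hodgeLie ι₁ π₁ ι₂ π₂ hπι₁ hπι₂ hsum hz𝔥
    obtain ⟨x₁, hx₁⟩ := hZ₁ ψ₁ _ (Submodule.mem_inf.2 ⟨comp_mem_hodgeLie_of_retract ι₁ π₁ hπι₁ hz𝔥,
      ((π₁.comp (endAlg.toHom ⟨z, hzE⟩)).comp ι₁).toLinearMap_mem_endAlg⟩)
    obtain ⟨x₂, hx₂⟩ := hZ₂ ψ₂ _ (Submodule.mem_inf.2 ⟨comp_mem_hodgeLie_of_retract ι₂ π₂ hπι₂ hz𝔥,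
      ((π₂.comp (endAlg.toHom ⟨z, hzE⟩)).comp ι₂).toLinearMap_mem_endAlg⟩)
    refine ⟨x₁, x₂, ?_⟩
    rw [hb, hx₁, hx₂]
    simp only [LinearMap.smul_comp, LinearMap.comp_smul]
  -- the block restrictions of `𝔞` are onto (rigid factors)
  have hrig₁ := hodgeLie_rigid_of_ribetTypeOne hT φ hd hφ hAE h1 hdim
  have hrig₂ := hodgeLie_rigid_of_ribetTypeOne hT' φ' hd' hφ' hA'E h1' hdim'
  have himg₁ := map_restrict_eq_hodgeLie_of_rigid ι₁ π₁ hπι₁ hrig₁ 𝔞 h𝔞 hbr hΘex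
  have himg₂ := map_restrict_eq_hodgeLie_of_rigid ι₂ π₂ hπι₂ hrig₂ 𝔞 h𝔞 hbr hΘex
  -- counting: both derived corners lie in `𝔞`
  have h99₁ : 3 * 3 ≤ A.dim * A.dim := Nat.mul_le_mul hdim hdim
  have h99₂ : 3 * 3 ≤ A'.dim * A'.dim := Nat.mul_le_mul hdim' hdim'
  have hne2 : A.dim * A.dim + 2 ≤ A'.dim * A'.dim ∨ A'.dim * A'.dim + 2 ≤ A.dim * A.dim := by
    rcases Nat.lt_or_gt_of_ne hne with h | h
    · left
      have h' : (A.dim + 1) * (A.dim + 1) ≤ A'.dim * A'.dim := Nat.mul_le_mul h h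
      nlinarith
    · right
      have h' : (A'.dim + 1) * (A'.dim + 1) ≤ A.dim * A.dim := Nat.mul_le_mul h h
      nlinarith
  obtain ⟨hc₁, hc₂, hge₁, hge₂⟩ := UnitaryPair.corners_le_of_subalgebra_of_finrank_ne ι₁ π₁ ι₂ π₂ hπι₁ hπι₂ hsum 𝔞 h𝔞 hbr himg₁ himg₂ h9₁ h9₂
    (by omega) (by omega) hne2 h8₁ h8₂ hsimple₁ hsimple₂
  -- `[𝔥,𝔥] ⊆ 𝔞` (block-diagonal commutators are sums of corners)
  have h𝔡𝔞 : Submodule.span ℚ {B | ∃ X' ∈ H.hodgeLie, ∃ Y ∈ H.hodgeLie, X' * Y - Y * X' = B} ≤ 𝔞 := by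
    refine Submodule.span_le.2 ?_
    rintro _ ⟨X', hX', Y, hY, rfl⟩
    have hc := H.commutator_mem_hodgeLie hX' hY
    have hB₁ : (π₁.toLinearMap ∘ₗ X' ∘ₗ ι₁.toLinearMap) * (π₁.toLinearMap ∘ₗ Y ∘ₗ ι₁.toLinearMap) -
        (π₁.toLinearMap ∘ₗ Y ∘ₗ ι₁.toLinearMap) * (π₁.toLinearMap ∘ₗ X' ∘ₗ ι₁.toLinearMap) =
        π₁.toLinearMap ∘ₗ (X' * Y - Y * X') ∘ₗ ι₁.toLinearMap := by
      rw [LinearMap.sub_comp, LinearMap.comp_sub, restrict_mul ι₁ π₁ hπι₁ hY, restrict_mul ι₁ π₁ hπι₁ hX']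
    have hB₂ : (π₂.toLinearMap ∘ₗ X' ∘ₗ ι₂.toLinearMap) * (π₂.toLinearMap ∘ₗ Y ∘ₗ ι₂.toLinearMap) -
        (π₂.toLinearMap ∘ₗ Y ∘ₗ ι₂.toLinearMap) * (π₂.toLinearMap ∘ₗ X' ∘ₗ ι₂.toLinearMap) =
        π₂.toLinearMap ∘ₗ (X' * Y - Y * X') ∘ₗ ι₂.toLinearMap := by
      rw [LinearMap.sub_comp, LinearMap.comp_sub, restrict_mul ι₂ π₂ hπι₂ hY, restrict_mul ι₂ π₂ hπι₂ hX']
    have hm₁ : ι₁.toLinearMap ∘ₗ (π₁.toLinearMap ∘ₗ (X' * Y - Y * X') ∘ₗ ι₁.toLinearMap) ∘ₗ π₁.toLinearMap ∈ 𝔞 :=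
      hc₁ ⟨_, Submodule.subset_span ⟨_, comp_mem_hodgeLie_of_retract ι₁ π₁ hπι₁ hX', _, comp_mem_hodgeLie_of_retract ι₁ π₁ hπι₁ hY, hB₁⟩, rfl⟩
    have hm₂ : ι₂.toLinearMap ∘ₗ (π₂.toLinearMap ∘ₗ (X' * Y - Y * X') ∘ₗ ι₂.toLinearMap) ∘ₗ π₂.toLinearMap ∈ 𝔞 :=
      hc₂ ⟨_, Submodule.subset_span ⟨_, comp_mem_hodgeLie_of_retract ι₂ π₂ hπι₂ hX', _, comp_mem_hodgeLie_of_retract ι₂ π₂ hπι₂ hY, hB₂⟩, rfl⟩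
    rw [SetLike.mem_coe, eq_sum_blocks_of_mem_hodgeLie ι₁ π₁ ι₂ π₂ hπι₁ hπι₂ hsum hc]
    exact Submodule.add_mem _ hm₁ hm₂
  -- dimensions of `𝔥`
  have h0 : 0 < (A.prod A').dim := by rw [dim_prod]; omega
  have hup : Module.finrank ℚ H.hodgeLie ≤ A.dim * A.dim + A'.dim * A'.dim := by
    have h := finrank_hodgeLie_hodge_one_le_add_of_isIsogenous_prod hT hT' hP (IsIsogenous.refl _)
    rw [h9₁, h9₂] at h
    exact h
  refine (Submodule.eq_of_le_of_finrank_le h𝔞 ?_).ge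
  rcases isEmpty_or_nonempty (A'.endAlgebra →+* A.endAlgebra) with hfor | hfor
  · -- different fields: the trace test puts `ι₁φ₁π₁ ∈ 𝔞`, so the whole block `ι₁𝔥₁π₁ ⊆ 𝔞`
    obtain ⟨Θ, hΘ𝔞, hΘ⟩ := hΘex
    have hfree : ∀ s : ℚ, (d : ℚ) ≠ s ^ 2 * d' := forall_ne_sq_mul_of_isEmpty_ringHom hfor hA'E hd' hφ' hφ hd
    obtain ⟨hE₁𝔞, -⟩ := UnitaryPair.incl_phi_proj_mem_of_subalgebra_of_nonresonant ι₁ π₁ ι₂ π₂ hπι₁ hπι₂ hsum hφ₁E hφ₂E ψ hZ hd₁Q hφ₁2 hd₂Q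
      hφ₂2 hσ₁ hσ₂ hk₁ hk₂ hτ₁ hτ₂ hfree 𝔞 h𝔞 h𝔡𝔞 hΘ hΘ𝔞
    let L₁ : Module.End ℚ (bettiCohomology A.X 1) →ₗ[ℚ] Module.End ℚ (bettiCohomology (A.prod A').X 1) :=
      (LinearMap.llcomp ℚ _ (bettiCohomology A.X 1) _ ι₁.toLinearMap).comp (LinearMap.lcomp ℚ (bettiCohomology A.X 1) π₁.toLinearMap)
    let r₂ : Module.End ℚ (bettiCohomology (A.prod A').X 1) →ₗ[ℚ] Module.End ℚ (bettiCohomology A'.X 1) :=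
      (LinearMap.llcomp ℚ (bettiCohomology A'.X 1) _ _ π₂.toLinearMap).comp (LinearMap.lcomp ℚ _ ι₂.toLinearMap)
    have hL₁ : ∀ Y, L₁ Y = ι₁.toLinearMap ∘ₗ Y ∘ₗ π₁.toLinearMap := fun Y => rfl
    have hr₂ : ∀ Z, r₂ Z = π₂.toLinearMap ∘ₗ Z ∘ₗ ι₂.toLinearMap := fun Z => rfl
    -- `ι₁ 𝔥₁ π₁ ⊆ 𝔞`: `𝔥₁ = ℚφ₁ ⊕ 𝔡₁`
    have hblock₁ : H₁.hodgeLie.map L₁ ≤ 𝔞 ⊓ LinearMap.ker r₂ := by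
      rintro _ ⟨Y, hY, rfl⟩
      refine Submodule.mem_inf.2 ⟨?_, ?_⟩
      · have hdec := hodgeLie_hodge_one_center_sup_derived hT
        rw [← hdec] at hY
        obtain ⟨z, hz, e, he, rfl⟩ := Submodule.mem_sup.1 hY
        obtain ⟨c, rfl⟩ := hZ₁ ψ₁ z hz
        rw [hL₁]
        simp only [LinearMap.comp_add, LinearMap.add_comp, LinearMap.comp_smul, LinearMap.smul_comp]
        exact Submodule.add_mem _ (Submodule.smul_mem _ _ hE₁𝔞) (hc₁ ⟨e, he, rfl⟩)
      · rw [LinearMap.mem_ker, hr₂, hL₁]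
        refine LinearMap.ext fun v => ?_
        have h21 : π₂.toLinearMap (ι₁.toLinearMap (Y (π₁.toLinearMap (ι₂.toLinearMap v)))) = 0 := by
          have h := congrArg (fun f : bettiCohomology A.X 1 →ₗ[ℚ] bettiCohomology A'.X 1 => f (Y (π₁.toLinearMap (ι₂.toLinearMap v))))
            (UnitaryPair.proj₂_comp_incl₁ ι₁ π₁ ι₂ π₂ hπι₁ hπι₂ hsum)
          simpa only [LinearMap.comp_apply, LinearMap.zero_apply] using h
        simp only [LinearMap.comp_apply, LinearMap.zero_apply, h21]
    -- count: `dim 𝔞 ≥ g² + g′²`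
    obtain ⟨hrank, -⟩ := UnitaryPair.finrank_inf_ker_le_one_or ι₁ π₁ ι₂ π₂ hπι₁ hπι₂ hsum 𝔞 h𝔞 hbr himg₁ himg₂ h9₁ h8₁ hsimple₁
    have hrank' : Module.finrank ℚ 𝔞 = Module.finrank ℚ ↥(𝔞 ⊓ LinearMap.ker r₂) + Module.finrank ℚ H₂.hodgeLie := hrank
    have hinj : Module.finrank ℚ H₁.hodgeLie ≤ Module.finrank ℚ ↥(H₁.hodgeLie.map L₁) := by
      rw [← LinearMap.range_domRestrict, LinearMap.finrank_range_of_inj]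
      intro x y hxy
      apply Subtype.ext
      have h := congrArg (fun Z : Module.End ℚ (bettiCohomology (A.prod A').X 1) => π₁.toLinearMap ∘ₗ Z ∘ₗ ι₁.toLinearMap) hxy
      have e : ∀ Y : Module.End ℚ (bettiCohomology A.X 1), π₁.toLinearMap ∘ₗ (L₁ Y) ∘ₗ ι₁.toLinearMap = Y :=
        fun Y => LinearMap.ext fun v => by simp only [hL₁, LinearMap.comp_apply, hπι₁]
      have h' : π₁.toLinearMap ∘ₗ (L₁ (x : Module.End ℚ (bettiCohomology A.X 1))) ∘ₗ ι₁.toLinearMap =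
          π₁.toLinearMap ∘ₗ (L₁ (y : Module.End ℚ (bettiCohomology A.X 1))) ∘ₗ ι₁.toLinearMap := h
      rwa [e, e] at h'
    have hM := Submodule.finrank_mono hblock₁
    have h9₁' : Module.finrank ℚ H₁.hodgeLie = A.dim * A.dim := h9₁
    have h9₂' : Module.finrank ℚ H₂.hodgeLie = A'.dim * A'.dim := h9₂
    omega
  · -- isomorphic fields: `dim 𝔥 = g² + g′² − 1`
    have ht := mtRank_hodge_one_eq_of_isIsogenous_prod_ribetTypeOne_of_nonempty_ringHom' hP hF hnR φ hd hφ hAE h1 hdim hF' hnR' φ' hd' hφ' hA'E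
      h1' hdim' hfor hni (IsIsogenous.refl _)
    rw [mtRank_hodge_one_eq_finrank_hodgeLie_add_one hP h0] at ht
    have ht' : Module.finrank ℚ H.hodgeLie + 1 = A.dim * A.dim + A'.dim * A'.dim := ht
    omega

/-- **`t(X) ≥ t(A × A′)` for every `X ∼ (A × A′) × Y`**, `A`, `A′` of Ribet types `(g−1,1)`, `(g′−1,1)` with `g ≠ g′` (rigidity §1 and
`mtRank_hodge_one_le_of_isIsogenous_prod_of_rigid`): a Ribet pair of different dimensions is a MONOTONE FACTOR of the ladder.
[cite: MoonenZarhin1999LowDim, §3 (3.1)] [cite: Ribet1983, Thm. 3] -/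
theorem mtRank_hodge_one_le_of_isIsogenous_prod_ribetTypeOne_prod (hX : IsSmoothProjective n X.X) {A A' Y : AbelianVariety ℂ} {m : ℕ}
    (hP : IsSmoothProjective m (A.prod A').X)
    (hF : IsField A.endAlgebra) (hnR : ¬ IsTotallyReal (EndField A hF)) (φ : A ⟶ A) {d : ℕ} (hd : 0 < d) (hφ : φ ≫ φ = -(d • 𝟙 A))
    (hAE : Module.finrank ℚ A.endAlgebra = 2)
    (h1 : eigenMultiplicity A φ (Complex.I * (Real.sqrt d : ℂ)) = 1 ∨ eigenMultiplicity A φ (-(Complex.I * (Real.sqrt d : ℂ))) = 1) (hdim : 3 ≤ A.dim)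
    (hF' : IsField A'.endAlgebra) (hnR' : ¬ IsTotallyReal (EndField A' hF')) (φ' : A' ⟶ A') {d' : ℕ} (hd' : 0 < d') (hφ' : φ' ≫ φ' = -(d' • 𝟙 A'))
    (hA'E : Module.finrank ℚ A'.endAlgebra = 2)
    (h1' : eigenMultiplicity A' φ' (Complex.I * (Real.sqrt d' : ℂ)) = 1 ∨ eigenMultiplicity A' φ' (-(Complex.I * (Real.sqrt d' : ℂ))) = 1)
    (hdim' : 3 ≤ A'.dim) (hne : A.dim ≠ A'.dim) (hXP : IsIsogenous X ((A.prod A').prod Y)) :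
    haveI := BettiUniverse.finite hX 1
    haveI := BettiUniverse.finite hP 1
    (BettiUniverse.hodge exists_isReal_hodgeModel_holds hP 1).mtRank ≤ (BettiUniverse.hodge exists_isReal_hodgeModel_holds hX 1).mtRank :=
  mtRank_hodge_one_le_of_isIsogenous_prod_of_rigid hX hP (by rw [dim_prod]; omega)
    (hodgeLie_rigid_prod_ribetTypeOne_of_dim_ne hP hF hnR φ hd hφ hAE h1 hdim hF' hnR' φ' hd' hφ' hA'E h1' hdim' hne) hXP

end Summit.HodgeConjecture.CorCM

end
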